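import Summits.Ventures.PercRepro.RankDistLoop

/-!
# PercRepro — the cumulative shadow inequality under the deletion of a coloop (p9, gen 18)

A COLOOP `e` of `M` (rank `p + 1`) lies in no bottom set (`notMem_of_mem_Uq_of_isColoop`); the bottom sets of
`(p, q)` in `M ∖ e` are the bottom sets of `(p+1, q)` of `M` (`mem_Uq_delete_iff_of_isColoop`), and every level of
the shadow splits as `s_{v+1}(M; p+1, q) = s_{v+1}(M ∖ e; p, q) + s_v(M ∖ e; p, q)` (`card_shadowLev_of_isColoop`).
Hence **`shadowCumulative_of_isColoop`**: `ShadowCumulative (M ∖ e) p (q+1)` gives `ShadowCumulative M (p+1) (q+1)`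
— at the levels below the top by Pascal's rule, and at the top level `u = p` from the inequality one level down
together with the lossy one-step `s_{p−1} ≤ p·s_p` of `RankDistLoop` (`card_shadowLev_le_succ_mul`) and the
identities `(L+1)·C(L, v) = C(L+1, v+1)·(v+1)`, `(L+1)·C(L, q+1) = C(L+1, q+1)·(L − q)`. Nothing here is a
statement about any window of the crux.
-/

namespace PercRepro.RankDist

open Set Finset Matroid PercRepro.ThmH

variable {α : Type} [DecidableEq α] (M : Matroid α) [M.Finite]

/-! ### Coloops -/

omit [DecidableEq α] [M.Finite] in
/-- Adjoining a coloop raises the rank by one. -/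
lemma eRk_insert_of_isColoop {e : α} (he : M.IsColoop e) {X : Set α} (heX : e ∉ X) :
    M.eRk (insert e X) = M.eRk X + 1 :=
  Matroid.eRk_insert_eq_add_one ⟨he.mem_ground, fun h => heX (he.mem_closure_iff_mem.1 h)⟩

omit [DecidableEq α] [M.Finite] in
/-- Deleting a coloop drops the rank by exactly one. -/
lemma eRank_delete_of_isColoop_add_one {e : α} (he : M.IsColoop e) :
    (M.delete {e}).eRank + 1 = M.eRank := by
  rw [← Matroid.eRk_ground, ← Matroid.eRk_ground, Matroid.delete_ground,
    deleteElem_eRk_eq M (subset_refl _), ← eRk_insert_of_isColoop M he (fun h => h.2 rfl),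
    Set.insert_sdiff_singleton, Set.insert_eq_of_mem he.mem_ground]

/-- For a coloop `e` of `M`, the bottom sets of `(p, q)` in `M ∖ e` are the bottom sets of `(p+1, q)` of `M`
avoiding `e`. -/
lemma mem_Uq_delete_iff_of_isColoop {p q : ℕ} {e : α} (he : M.IsColoop e) {B : Finset α} :
    B ∈ PerFlat.Uq (M.delete {e}) p q ↔ B ∈ PerFlat.Uq M (p + 1) q ∧ e ∉ B := by
  rw [PerFlat.mem_Uq, PerFlat.mem_Uq, gr_delete]
  have hcoe : (((gr M).erase e \ B : Finset α) : Set α) = M.E \ insert e (B : Set α) := by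
    rw [Finset.coe_sdiff, Finset.coe_erase, coe_gr, Set.sdiff_sdiff, Set.insert_eq]
  have hsub : M.E \ insert e (B : Set α) ⊆ M.E \ {e} :=
    Set.sdiff_subset_sdiff_right (Set.singleton_subset_iff.2 (Set.mem_insert _ _))
  have hins : e ∉ B → insert e (M.E \ insert e (B : Set α)) = M.E \ (B : Set α) := by
    intro hBe
    ext x
    simp only [Set.mem_insert_iff, Set.mem_sdiff]
    constructor
    · rintro (rfl | ⟨hxE, hx⟩)
      · exact ⟨he.mem_ground, hBe⟩
      · exact ⟨hxE, fun hh => hx (Or.inr hh)⟩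
    · rintro ⟨hxE, hxB⟩
      by_cases hxe : x = e
      · exact Or.inl hxe
      · exact Or.inr ⟨hxE, fun hh => hh.elim hxe hxB⟩
  constructor
  · rintro ⟨hB, hBq, hBp⟩
    have hBe : e ∉ B := fun hh => (Finset.mem_erase.1 (hB hh)).1 rfl
    have hBE : (B : Set α) ⊆ M.E \ {e} := by
      rw [← coe_gr, ← Finset.coe_erase]; exact_mod_cast hB
    rw [deleteElem_eRk_eq M hBE] at hBq
    rw [hcoe, deleteElem_eRk_eq M hsub] at hBp
    refine ⟨⟨fun x hx => (Finset.mem_erase.1 (hB hx)).2, hBq, ?_⟩, hBe⟩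
    rw [Finset.coe_sdiff, coe_gr, ← hins hBe, eRk_insert_of_isColoop M he (fun h => h.2 (Or.inl rfl)), hBp]
    push_cast; rfl
  · rintro ⟨⟨hB, hBq, hBp⟩, hBe⟩
    have hBE : (B : Set α) ⊆ M.E \ {e} := by
      intro x hx
      exact ⟨by rw [← coe_gr]; exact_mod_cast hB hx,
        fun hh => hBe (by rw [mem_singleton_iff] at hh; rw [← hh]; exact hx)⟩
    refine ⟨fun x hx => Finset.mem_erase.2 ⟨fun hh => hBe (hh ▸ hx), hB hx⟩, ?_, ?_⟩
    · rw [deleteElem_eRk_eq M hBE]; exact hBq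
    · rw [hcoe, deleteElem_eRk_eq M hsub]
      rw [Finset.coe_sdiff, coe_gr, ← hins hBe, eRk_insert_of_isColoop M he (fun h => h.2 (Or.inl rfl))] at hBp
      have : M.eRk (M.E \ insert e (B : Set α)) + 1 = (p : ℕ∞) + 1 := by rw [hBp]; push_cast; rfl
      exact WithTop.add_right_cancel ENat.one_ne_top this

/-- A coloop lies in no bottom set of `(p+1, q)` (for `eRank M = p + 1`). -/
lemma notMem_of_mem_Uq_of_isColoop {p q : ℕ} {e : α} (he : M.IsColoop e) (hr : M.eRank = (p + 1 : ℕ))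
    {B : Finset α} (hB : B ∈ PerFlat.Uq M (p + 1) q) : e ∉ B := by
  intro heB
  rw [PerFlat.mem_Uq] at hB
  obtain ⟨-, -, hBp⟩ := hB
  rw [Finset.coe_sdiff, coe_gr] at hBp
  have h1 : M.eRk (M.E \ (B : Set α)) ≤ M.eRk (M.E \ {e}) :=
    M.eRk_mono (Set.sdiff_subset_sdiff_right (Set.singleton_subset_iff.2 heB))
  have h2 := eRank_delete_of_isColoop_add_one M he
  rw [← Matroid.eRk_ground, Matroid.delete_ground, deleteElem_eRk_eq M (subset_refl _), hr] at h2
  have h3 : M.eRk (M.E \ {e}) = (p : ℕ) :=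
    WithTop.add_right_cancel ENat.one_ne_top (h2.trans (Nat.cast_succ p))
  rw [hBp, h3] at h1
  have : p + 1 ≤ p := by exact_mod_cast h1
  omega

open scoped Classical in
/-- **A coloop splits every level of the shadow**: `s_{v+1}(M; p+1, q) = s_{v+1}(M ∖ e; p, q) + s_v(M ∖ e; p, q)`. -/
theorem card_shadowLev_of_isColoop {p q v : ℕ} {e : α} (he : M.IsColoop e) (hr : M.eRank = (p + 1 : ℕ)) :
    (shadowLev M (v + 1) (PerFlat.Uq M (p + 1) q)).card
      = (shadowLev (M.delete {e}) (v + 1) (PerFlat.Uq (M.delete {e}) p q)).card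
        + (shadowLev (M.delete {e}) v (PerFlat.Uq (M.delete {e}) p q)).card := by
  have heE : e ∈ M.E := he.mem_ground
  have h0 : (shadowLev M (v + 1) (PerFlat.Uq M (p + 1) q)).filter (fun A => e ∉ A)
      = shadowLev (M.delete {e}) (v + 1) (PerFlat.Uq (M.delete {e}) p q) := by
    ext A
    rw [Finset.mem_filter, mem_shadowLev, mem_shadowLev, Matroid.delete_ground]
    constructor
    · rintro ⟨⟨hAE, hAu, B, hB, hBA⟩, heA⟩
      have hAE' : A ⊆ M.E \ {e} := Set.subset_sdiff.2 ⟨hAE, Set.disjoint_singleton_right.2 heA⟩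
      refine ⟨hAE', ?_, B, (mem_Uq_delete_iff_of_isColoop M he).2 ⟨hB, fun hh => heA (hBA hh)⟩, hBA⟩
      have hAE'' : A ⊆ (M.delete {e}).E := by rw [Matroid.delete_ground]; exact hAE'
      rw [rk_eq_iff (M.delete {e}) hAE'', deleteElem_eRk_eq M hAE', ← rk_eq_iff M hAE]
      exact hAu
    · rintro ⟨hAE', hAu, B, hB, hBA⟩
      have heA : e ∉ A := fun hh => (hAE' hh).2 rfl
      have hAE : A ⊆ M.E := hAE'.trans Set.sdiff_subset
      refine ⟨⟨hAE, ?_, B, ((mem_Uq_delete_iff_of_isColoop M he).1 hB).1, hBA⟩, heA⟩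
      have hAE'' : A ⊆ (M.delete {e}).E := by rw [Matroid.delete_ground]; exact hAE'
      rw [rk_eq_iff (M.delete {e}) hAE'', deleteElem_eRk_eq M hAE', ← rk_eq_iff M hAE] at hAu
      exact hAu
  have h1 : ((shadowLev M (v + 1) (PerFlat.Uq M (p + 1) q)).filter (fun A => e ∈ A)).card
      = (shadowLev (M.delete {e}) v (PerFlat.Uq (M.delete {e}) p q)).card := by
    apply Finset.card_bij (fun A _ => A \ {e})
    · intro A hA
      rw [Finset.mem_filter, mem_shadowLev] at hA
      obtain ⟨⟨hAE, hAu, B, hB, hBA⟩, heA⟩ := hA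
      rw [mem_shadowLev, Matroid.delete_ground]
      have hAE' : A \ {e} ⊆ M.E \ {e} := Set.sdiff_subset_sdiff_left hAE
      have hAE'' : A \ {e} ⊆ (M.delete {e}).E := by rw [Matroid.delete_ground]; exact hAE'
      have hBe : e ∉ B := notMem_of_mem_Uq_of_isColoop M he hr hB
      refine ⟨hAE', ?_, B, (mem_Uq_delete_iff_of_isColoop M he).2 ⟨hB, hBe⟩, ?_⟩
      · rw [rk_eq_iff (M.delete {e}) hAE'', deleteElem_eRk_eq M hAE']
        have h2 := eRk_insert_of_isColoop M he (X := A \ {e}) (fun h => h.2 rfl)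
        rw [Set.insert_sdiff_singleton, Set.insert_eq_of_mem heA, eRk_eq_coe_rk M hAE, hAu] at h2
        exact WithTop.add_right_cancel ENat.one_ne_top (h2.symm.trans (Nat.cast_succ v))
      · intro x hx
        exact ⟨hBA hx, fun hh => hBe (by rw [mem_singleton_iff] at hh; rw [← hh]; exact hx)⟩
    · intro A hA A' hA' hAA'
      rw [Finset.mem_filter] at hA hA'
      rw [← insert_eq_of_mem hA.2, ← insert_eq_of_mem hA'.2, ← Set.insert_sdiff_singleton,
        ← Set.insert_sdiff_singleton (s := A'), hAA']
    · intro A'' hA''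
      rw [mem_shadowLev, Matroid.delete_ground] at hA''
      obtain ⟨hA''E, hA''v, B, hB, hBA⟩ := hA''
      have heA'' : e ∉ A'' := fun hh => (hA''E hh).2 rfl
      have hA''E' : A'' ⊆ M.E := hA''E.trans Set.sdiff_subset
      refine ⟨insert e A'', ?_, ?_⟩
      · rw [Finset.mem_filter, mem_shadowLev]
        refine ⟨⟨insert_subset heE hA''E', ?_, B, ((mem_Uq_delete_iff_of_isColoop M he).1 hB).1,
          hBA.trans (subset_insert _ _)⟩, mem_insert e A''⟩
        have hA''E'' : A'' ⊆ (M.delete {e}).E := by rw [Matroid.delete_ground]; exact hA''E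
        rw [rk_eq_iff (M.delete {e}) hA''E'', deleteElem_eRk_eq M hA''E] at hA''v
        rw [rk_eq_iff M (insert_subset heE hA''E'), eRk_insert_of_isColoop M he heA'', hA''v]
        push_cast; rfl
      · rw [Set.insert_sdiff_of_mem _ (mem_singleton e), sdiff_singleton_eq_self heA'']
  have key := Finset.card_filter_add_card_filter_not (fun A => e ∈ A)
    (s := shadowLev M (v + 1) (PerFlat.Uq M (p + 1) q))
  rw [← h0, ← h1, ← key, Nat.add_comm]

/-- **(SC) is inherited from `M ∖ e` for a coloop `e`**: `ShadowCumulative (M ∖ e) p (q+1)` gives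
`ShadowCumulative M (p+1) (q+1)` when `eRank M = p + 1`. -/
theorem shadowCumulative_of_isColoop {p q : ℕ} {e : α} (he : M.IsColoop e) (hr : M.eRank = (p + 1 : ℕ))
    (hD : ShadowCumulative (M.delete {e}) p (q + 1)) : ShadowCumulative M (p + 1) (q + 1) := by
  intro u hqu hup
  obtain ⟨v, rfl⟩ : ∃ v, u = v + 1 := ⟨u - 1, by omega⟩
  rw [card_shadowLev_of_isColoop M he hr (v := q), card_shadowLev_of_isColoop M he hr (v := v),
    shadowLev_eq_empty_of_lt (M.delete {e}) (show q < q + 1 by omega), Finset.card_empty, add_zero]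
  have hrD : (M.delete {e}).eRank = (p : ℕ) := by
    have h2 := eRank_delete_of_isColoop_add_one M he
    rw [hr] at h2
    exact WithTop.add_right_cancel ENat.one_ne_top (h2.trans (Nat.cast_succ p))
  set L := p + (q + 1) with hL
  set s0 := (shadowLev (M.delete {e}) (q + 1) (PerFlat.Uq (M.delete {e}) p (q + 1))).card
  set s1 := (shadowLev (M.delete {e}) (v + 1) (PerFlat.Uq (M.delete {e}) p (q + 1))).card
  set s2 := (shadowLev (M.delete {e}) v (PerFlat.Uq (M.delete {e}) p (q + 1))).card
  have eN : p + 1 + (q + 1) = L + 1 := by rw [hL]; ring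
  rw [eN]
  -- the inequality at level `v` (trivial at `v = q + 1`)
  have hv : s0 * L.choose v ≤ s2 * L.choose (q + 1) := by
    rcases Nat.lt_or_ge (q + 1) v with hlt | hge
    · exact hD v hlt (by omega)
    · have : v = q + 1 := by omega
      subst this; exact le_refl _
  rcases Nat.lt_or_ge (v + 1) p with hlt | hge
  · -- below the top: Pascal
    have hv1 : s0 * L.choose (v + 1) ≤ s1 * L.choose (q + 1) := hD (v + 1) hqu hlt
    have hpas : (L + 1).choose (v + 1) = L.choose v + L.choose (v + 1) := Nat.choose_succ_succ L v
    have hmono : L.choose (q + 1) ≤ (L + 1).choose (q + 1) := Nat.choose_le_choose _ (Nat.le_succ L)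
    calc s0 * (L + 1).choose (v + 1) = s0 * L.choose v + s0 * L.choose (v + 1) := by rw [hpas]; ring
      _ ≤ s2 * L.choose (q + 1) + s1 * L.choose (q + 1) := Nat.add_le_add hv hv1
      _ = (s1 + s2) * L.choose (q + 1) := by ring
      _ ≤ (s1 + s2) * (L + 1).choose (q + 1) := Nat.mul_le_mul_left _ hmono
  · -- the top level `v + 1 = p`: the inequality one level down and the lossy one-step
    have hvp : v + 1 = p := by omega
    have hlossy : s2 ≤ (v + 1) * s1 := by
      apply card_shadowLev_le_succ_mul (M.delete {e}) _ (u := v)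
      rw [hrD, ← hvp]; exact_mod_cast Nat.lt_succ_self v
    have e1 := Nat.add_one_mul_choose_eq L v
    have e2 := Nat.add_one_mul_choose_eq L (q + 1)
    have e3 := Nat.choose_succ_right_eq (L + 1) (q + 1)
    have e4 : L + 1 - (q + 1) = v + 2 := by omega
    rw [e4] at e3
    have hpos : 0 < v + 1 := Nat.succ_pos v
    apply Nat.le_of_mul_le_mul_left _ hpos
    calc (v + 1) * (s0 * (L + 1).choose (v + 1)) = s0 * ((L + 1).choose (v + 1) * (v + 1)) := by ring
      _ = s0 * ((L + 1) * L.choose v) := by rw [e1]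
      _ = (L + 1) * (s0 * L.choose v) := by ring
      _ ≤ (L + 1) * (s2 * L.choose (q + 1)) := Nat.mul_le_mul_left _ hv
      _ = s2 * ((L + 1) * L.choose (q + 1)) := by ring
      _ = s2 * ((L + 1).choose (q + 1 + 1) * (q + 1 + 1)) := by rw [e2]
      _ = s2 * ((L + 1).choose (q + 1) * (v + 2)) := by rw [e3]
      _ = (v + 1) * (s2 * (L + 1).choose (q + 1)) + s2 * (L + 1).choose (q + 1) := by ring
      _ ≤ (v + 1) * (s2 * (L + 1).choose (q + 1)) + (v + 1) * s1 * (L + 1).choose (q + 1) :=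
          Nat.add_le_add_left (Nat.mul_le_mul_right _ hlossy) _
      _ = (v + 1) * ((s1 + s2) * (L + 1).choose (q + 1)) := by ring

end PercRepro.RankDist
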